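/-
Copyright (c) 2026 the pub-hodgecm-mathlib formalisation cell (harness21).  Prover seat hodgecm-mathlib-LA3-p01 (g0), «GO 500» half A line L3
(socket `stub_FROB`, road ROOF → `stub_ROOF0`), organ #3 «THE LEGS OF THE DOWNSTAIRS ROOF» (LA3-plan (g0) deal v2 «then the legs into :137»); 2026-09-02.
-/
import Literature.AlgebraicGeometry.AbelianSchemes.RoofRetargetAlongRecognition
import Literature.AlgebraicGeometry.AbelianSchemes.SerreTwistExactPolarizationExists
import Literature.AlgebraicGeometry.AbelianSchemes.AbelianSchemeHomReductionSpecialFibre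
import Literature.AlgebraicGeometry.AbelianSchemes.AbelianSchemeDualTransportOfBaseChange
import HarnessLib

/-!
# The legs of the downstairs roof: the generic roof `𝒜_x —q→ B ←c— 𝒜_{x″}` re-targeted to the Serre-family fibre `𝒞_{x″} = (𝒜 ⊗_𝒪 𝔟)_{x″}` and REDUCED —
# `q̄ : 𝒜_{x̄} → 𝒞_{x̄″}` flat surjective, `𝒪`-equivariant, carrying level sections, with `q̄^*λ′_{x̄″} = N·λ_{x̄}` for the EXACT twisted polarisation `λ′`

Topic `AlgebraicGeometry/AbelianSchemes`, namespace `Literature.AlgebraicGeometry.AbelianSchemes.AbelianSchemeOver`.  THEOREMS ONLY (no definition, no named fact,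
no `instance`, no notation, no `sorry`).  Cell `hodgecm-mathlib` (D-0151), F0∕P6 «MOD», «GO 500» line L3 (socket `stub_FROB` of the D-line
`Cruxes/HLiu418/Lines/F0_P6a_DatumOfInputs.lean`), road ROOF → `stub_ROOF0` :137 of the closer skeleton v3 (A-p03 (g30) 6e8f16cc), organ **#3 «THE LEGS»** (LA3-plan (g0)
DEAL v2: «organ #2 (r-B) → then the legs into :137; (rL) consumed as a leaf input, no block laws inside the legs»).  Assembles ★ (ν8) `exists_specialFibre_hom_reduction`
(p847636) with ★ organ #1 `SerreTranslateCoverLeg` (p847713), ★ organ #1b `SerreTwistExactPolarizationExists` (p847767), ★ organ #2 `RoofRetargetAlongRecognition` (p847843)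
and ★ (γ2) `serreTwistPolPull`: the rows (r1₀) (r3₀-q) (r4₀-q) (r5₀-q) of `Roof₀` (P6a Defs ED. 3 :542) for the middle **`B̄ := ((𝒞 ×_𝓨 𝓨_s) ×_{𝓨_s} x̄″`**, `𝒞 := 𝒜 ⊗_𝒪 𝔟` the Serre
family of the universal tuple, and the dual homomorphism **`λ_B̄ := λ′_{x̄″}`** of the EXACT twisted polarisation (`ψ_P^*λ′ = N·λ`) — from the UPSTAIRS roof in `RoofΩ`'s clause
shapes at two `Ω̄`-points `x, x″` of the generic fibre.  The c̄-rows (r2₀)(r3₀-c)(r4₀-c)(r5₀-c) are ★ organ #1; (rL) is the congruence-relation leaf's.  `--supports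
stmt-HodgeConjecture-24832`, count-neutral.  HONEST LABEL: HC_CM is proved only modulo the cell's 2 remaining named inputs (hLiu418 24832, h413 24833) until rung 0 closes;
this file discharges none of them.

## Mathematics

([SerreTate1968] §1; [BoschLutkebohmertRaynaud1990] §1.2 Prop. 8, §7.3 Prop. 6; [MumfordAV1970] §7 Thm. 4, §15 Thm. 1, §23 Thm. 2; [Conrad2004GrossZagier] §7 Thm. 7.5;
[RapoportSmithlingZhang2020Diagonal] §4.1 (p. 17), §4.3 (4.23) (p. 21).)  `𝓨` a proper model at `v`, `𝒜 → 𝓨` a commutative abelian scheme with `𝒪`-action `ι`, Serre data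
`(E′, P, Q, N)` presenting `𝔟 ≅ 𝔭⁻¹` (`𝔭 = (P_k)`, `QP = N`, `PQ = N·E′`, `N ≠ 0`), `𝒞 := 𝒜 ⊗_𝒪 𝔟` with `ψ_P : 𝒜 → 𝒞` and `ψ′ : 𝒞 → 𝒜`; dual pairs `D`, `D_𝔟` with unit
hypotheses, a polarisation `λ` of `𝒜`, the exact twisted `λ′ : 𝒞 → 𝒞^` (`ψ_P ≫ λ′ ≫ ψ_P^∨ = λ ≫ [N]`, `[N] ≫ λ′ = λ^{pull}`, ★ organ #1b under a Rosati pair); level structures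
`lvl` on `𝒜` and `lvl′` on `𝒞` with `lvl′.σ i = lvl.σ i ≫ ψ_P` (★ `SerreTwistLevel`).  UPSTAIRS at `x, x″ ∈ Y(Ω̄)` (`Ω̄ = (K_v)^alg`, characteristic `0`): a roof `𝒜_x —q→ B ←c— 𝒜_{x″}`
of homomorphisms with `q` finite surjective, `c` surjective with `Ker c(Ω̄) = 𝒜_{x″}[𝔭](Ω̄)` ((r2)), a dual homomorphism `λ_B` with `q^*λ_B = N·λ_x`, `c^*λ_B = N·λ_{x″}` ((r3)),
common intertwiners ((r4)) and `q(σ^a(x)) = c(σ^a(x″))` ((r5)).  THEN (★ organ #2) `B ≅ 𝒞_{x″}` under `𝒜_{x″}` by a unique `E`, `q′ := q ≫ E⁻¹ : 𝒜_x → 𝒞_{x″}` is a finite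
surjective homomorphism between FIBRES OF TWO FAMILIES, `ι`-equivariant, with `q′(σ^a(x)) = σ_𝒞^a(x″)` and `q′^*λ′_{x″} = N·λ_x`, hence `q′^*λ^{pull}_{x″} = N²·λ_x`
for the POLARISATION `λ^{pull}` (★ `serreTwistPolPull`); and ★ (ν8) reduces `q′` to **`q̄ : 𝒜_{x̄} → 𝒞_{x̄″}`** (`x̄ = red x`, `x̄″ = red x″`) with (i) flat surjective, (ii)
`ι_{x̄}(a) ≫ q̄ = q̄ ≫ ι^𝒞_{x̄″}(a)`, (iii) `q̄(σ^a(x̄)) = σ_𝒞^a(x̄″)`, (iv) `q̄^*λ^{pull}_{x̄″} = N²·λ_{x̄}`, whence — dividing by the fppf `[N]` DOWNSTAIRS (any characteristic;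
`λ^{pull}_{x̄″} = λ′_{x̄″} ≫ [N]`) — **`q̄^*λ′_{x̄″} = N·λ_{x̄}`**.  (The detour through `λ^{pull}` is forced by ★ (ν8)(iv), which transports laws of POLARISATIONS; `λ′` is only
known to be a homomorphism.)

## Contents
* §1 (generic bookkeeping) `comp_comp_mulN_comp_dualIsogenyOver` (multiply the similitude scalar), `comp_lam_comp_dualIsogenyOver_of_comp_mulN` (divide it, `k ≠ 0`),
  `baseChangeHom_baseChangeHom_of_pow_id_comp_eq` (`[N] ≫ λ′ = λ^{pull}` base-changes to `λ′_{··} ≫ [N] = λ^{pull}_{··}`), `LevelStructure.baseChange_section_`.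
* §2 **`exists_roofLeg_specialFibre`** — THE HEAD.
* §3 (ED. 2) `map_coverLeg_restrictPt_sectionBaseChange`, **`exists_roofLeg_specialFibre_sections`** — the sections editions (no twisted level structure on `𝒞`).

## References
* [SerreTate1968] J.-P. Serre, J. Tate, *Good reduction of abelian varieties*, Ann. of Math. 88 (1968), §1.
* [BoschLutkebohmertRaynaud1990] S. Bosch, W. Lütkebohmert, M. Raynaud, *Néron Models* (1990), §1.2 Prop. 8, §7.3 Prop. 6 (p. 180).
* [MumfordAV1970] D. Mumford, *Abelian Varieties* (1970), §7 Thm. 4 (p. 72), §15 Thm. 1 (p. 143), §23 Thm. 2 (p. 231).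
* [Conrad2004GrossZagier] B. Conrad, *Gross–Zagier revisited*, MSRI Publ. 49 (2004), §7 (Thm. 7.5).
* [RapoportSmithlingZhang2020Diagonal] M. Rapoport, B. Smithling, W. Zhang (2020), §4.1 (p. 17), §4.3 (4.23) (p. 21).
* [MumfordFogartyKirwan1994] D. Mumford, J. Fogarty, F. Kirwan, *GIT*, 3rd ed. (1994), Ch. 6 §1 Cor. 6.8 (p. 118), Ch. 7 §2 Def. 7.1–7.2 (p. 129).
-/

set_option autoImplicit false

noncomputable section

set_option backward.isDefEq.respectTransparency false

open CategoryTheory CategoryTheory.Limits AlgebraicGeometry MonoidalCategory CartesianMonoidalCategory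
open scoped MonObj CategoryTheory.Obj NumberField
open Literature.AlgebraicGeometry.Motives
open IsDedekindDomain IsDedekindDomain.HeightOneSpectrum ValuativeRel
open Literature.NumberTheory.EllipticCurves (genericFibre specGenericPoint)
open Literature.NumberTheory.GaloisRepresentations (closureValuationSubring)
open Literature.NumberTheory.DiophantineGeometry

namespace Literature.AlgebraicGeometry.AbelianSchemes

namespace AbelianSchemeOver

universe u

/-! ## §1 Generic bookkeeping: the similitude scalar multiplies and divides; `[N] ≫ λ′ = λ^{pull}` base-changes; base change of `σ^a` -/

section Bookkeeping

variable {S : Scheme.{u}} [IsReduced S] [IsLocallyNoetherian S] {A B : AbelianSchemeOver S} (DA : A.DualPair) (DB : B.DualPair)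
  (hDA : Nonempty ((Scheme.Modules.pullback (DualPair.unitHatSlice DA)).obj DA.P ≅ SheafOfModules.unit _))
  (hDB : Nonempty ((Scheme.Modules.pullback (DualPair.unitHatSlice DB)).obj DB.P ≅ SheafOfModules.unit _))
  (U : A.X ⟶ B.X) [IsMonHom U] (lamA : A.X ⟶ DA.hat.X) (lam : B.X ⟶ DB.hat.X) [IsMonHom lamA] [IsMonHom lam]

include hDA hDB in
omit [IsMonHom lamA] [IsMonHom lam] in
/-- **MULTIPLYING THE SIMILITUDE SCALAR**: `U ≫ λ ≫ U^∨ = λ_A ≫ [n]` ⟹ `U ≫ (λ ≫ [k]) ≫ U^∨ = λ_A ≫ [n·k]` (`[k]` commutes past the homomorphism `U^∨`, `[n][k] = [nk]`).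
[cite: MumfordFogartyKirwan1994, Ch. 6 §1 Cor. 6.5 (p. 117)] [cite: MumfordAV1970, §15 Thm. 1 (p. 143)] -/
theorem comp_comp_mulN_comp_dualIsogenyOver {n : ℕ} (k : ℕ) (h : U ≫ lam ≫ DualPair.dualIsogenyOver U DA DB = lamA ≫ DA.hat.mulN n) :
    U ≫ (lam ≫ DB.hat.mulN k) ≫ DualPair.dualIsogenyOver U DA DB = lamA ≫ DA.hat.mulN (n * k) := by
  haveI := DualPair.isMonHom_dualIsogenyOver U DA DB hDB hDA
  rw [Category.assoc, ← comp_mulN_eq_mulN_comp (DualPair.dualIsogenyOver U DA DB) k, ← mulN_comp_mulN, ← Category.assoc lamA, ← h]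
  simp only [Category.assoc]

include hDA hDB in
/-- **DIVIDING THE SIMILITUDE SCALAR** (`k ≠ 0`, ANY characteristic — `[k]` is an fppf cover of an abelian scheme): `U ≫ (λ ≫ [k]) ≫ U^∨ = λ_A ≫ [n·k]` ⟹
`U ≫ λ ≫ U^∨ = λ_A ≫ [n]` (★ `eq_of_comp_mulN_eq`). [cite: MumfordAV1970, §7 Thm. 4 (p. 72) and §15 Thm. 1 (p. 143)] -/
theorem comp_lam_comp_dualIsogenyOver_of_comp_mulN {n k : ℕ} (hk : k ≠ 0)
    (h : U ≫ (lam ≫ DB.hat.mulN k) ≫ DualPair.dualIsogenyOver U DA DB = lamA ≫ DA.hat.mulN (n * k)) :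
    U ≫ lam ≫ DualPair.dualIsogenyOver U DA DB = lamA ≫ DA.hat.mulN n := by
  haveI := DualPair.isMonHom_dualIsogenyOver U DA DB hDB hDA
  haveI : IsCommMonObj DA.hat.X := DA.hat.isCommMonObj_of_isReduced_base
  haveI : IsMonHom (DA.hat.mulN n) := DA.hat.isMonHom_mulN n
  refine eq_of_comp_mulN_eq A hk _ _ ?_
  rw [Category.assoc, Category.assoc, comp_mulN_eq_mulN_comp (DualPair.dualIsogenyOver U DA DB) k, Category.assoc, mulN_comp_mulN, ← h]
  simp only [Category.assoc]

omit [IsReduced S] [IsLocallyNoetherian S] [IsMonHom U] [IsMonHom lamA] in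
/-- **`[N] ≫ λ′ = λ^{pull}` BASE-CHANGES TO `λ′_{S″} ≫ [N] = λ^{pull}_{S″}`** at an iterated base change (functoriality, ★ `baseChangeHom_mulN`, `[N]` commuting past `λ′_{S″}`).
[cite: MumfordFogartyKirwan1994, Ch. 7 §2 Definition 7.2 (p. 129)] [cite: GortzWedhorn2020, Section (4.7) (pp. 107–108)] -/
theorem baseChangeHom_baseChangeHom_of_pow_id_comp_eq {S' S'' : Scheme.{u}} (g : S' ⟶ S) (s : S'' ⟶ S') {N : ℕ} (lampull : B.X ⟶ DB.hat.X)
    (h : ((𝟙 B.X) ^ N) ≫ lam = lampull) :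
    baseChangeHom (baseChangeHom lampull g) s = baseChangeHom (baseChangeHom lam g) s ≫ ((DB.baseChange g).baseChange s).hat.mulN N := by
  haveI := isMonHom_baseChangeHom lam g
  haveI : IsMonHom (baseChangeHom (baseChangeHom lam g) s) := isMonHom_baseChangeHom _ s
  rw [← h, ← mulN_def]
  change (Over.pullback s).map ((Over.pullback g).map (B.mulN N ≫ lam)) = _
  rw [Functor.map_comp, Functor.map_comp]
  change baseChangeHom (baseChangeHom (B.mulN N) g) s ≫ baseChangeHom (baseChangeHom lam g) s = _
  rw [B.baseChangeHom_mulN g N, (B.baseChange g).baseChangeHom_mulN s N, ← comp_mulN_eq_mulN_comp]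
  rfl

omit [IsReduced S] [IsLocallyNoetherian S] in
/-- `(lvl ×_S S′)(a) = lvl(a) ×_S S′` for Mumford's `σ^a` (★ `sectionBaseChange_sectionPow`). [cite: MumfordFogartyKirwan1994, Ch. 7 §2 Definition 7.2 (p. 129)] -/
theorem LevelStructure.baseChange_section_ {S' : Scheme.{u}} (g : S' ⟶ S) {g₀ n : ℕ} (lvl : A.LevelStructure g₀ n) (a : Fin g₀ ⊕ Fin g₀ → ZMod n) :
    (lvl.baseChange g).section_ a = A.sectionBaseChange g (lvl.section_ a) := by
  rw [LevelStructure.section_, LevelStructure.section_, sectionBaseChange_sectionPow]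
  rfl

end Bookkeeping

/-! ## §2 The legs of the downstairs roof -/

section Head

variable {K : Type} [Field K] [NumberField K] {v : HeightOneSpectrum (𝓞 K)} {Y : SchemeOver K}
  (𝓨 : IntegralModel (valuationSubringAtPrime K v) K Y) [IsProper 𝓨.total.hom] [IsReduced 𝓨.total.left] [IsLocallyNoetherian 𝓨.total.left]
  {𝒜 : AbelianSchemeOver 𝓨.total.left} {O : Type*} [CommRing O] (act : 𝒜.RingAction O) [IsCommMonObj 𝒜.X]
  {m : ℕ} (E' : Matrix (Fin m) (Fin m) O) (hE' : E' * E' = E') (P : Matrix (Fin m) (Fin 1) O) (Q : Matrix (Fin 1) (Fin m) O) {N : ℕ}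
  (x x'' : AlgPoints Y (AlgebraicClosure (v.adicCompletion K)))
  (D : 𝒜.DualPair) (Db : (serreTensor act E' hE').DualPair)
  (hD : Nonempty ((Scheme.Modules.pullback (DualPair.unitHatSlice D)).obj D.P ≅ SheafOfModules.unit _))
  (hDb : Nonempty ((Scheme.Modules.pullback (DualPair.unitHatSlice Db)).obj Db.P ≅ SheafOfModules.unit _))
  (pol : 𝒜.Polarization D)

include hD hDb in
set_option maxHeartbeats 400000 in
/-- **THE LEGS OF THE DOWNSTAIRS ROOF.**  In the setting of the module docstring (`𝓨` proper model at `v`; `𝒜 → 𝓨` commutative with `𝒪`-action and Serre data presenting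
`𝔟 ≅ 𝔭⁻¹`; `𝒞 = 𝒜 ⊗ 𝔟`; exact twisted `λ′` with `[N] ≫ λ′ = λ^{pull}`; `lvl′.σ i = lvl.σ i ≫ ψ_P`), from an UPSTAIRS roof `𝒜_x —q→ B ←c— 𝒜_{x″}` at `x, x″ ∈ Y(Ω̄)` with
`q` finite surjective, `c` surjective with `Ker c(Ω̄) = 𝒜_{x″}[𝔭](Ω̄)` on `Ω̄`-points, a dual homomorphism `λ_B` with `q^*λ_B = N·λ_x` and `c^*λ_B = N·λ_{x″}`, common intertwiners and
matching level points, THERE IS a homomorphism **`q̄ : (𝒜 ×_𝓨 𝓨_s)_{x̄} → (𝒞 ×_𝓨 𝓨_s)_{x̄″}`** (`x̄ = red x`, `x̄″ = red x″`) which is (r1₀) FLAT and SURJECTIVE, (r4₀-q) `ι`-EQUIVARIANT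
(`ι_{x̄}(a) ≫ q̄ = q̄ ≫ ι^𝒞_{x̄″}(a)`, the common endomorphism being the Serre action — cf. ★ `i_comp_coverLeg` for `c̄`), (r5₀-q) carries `σ^a(x̄)` to `σ_𝒞^a(x̄″)` (cf. ★
`map_coverLeg_restrictPt_section`), and (r3₀-q) satisfies **`q̄ ≫ λ′_{x̄″} ≫ q̄^∨ = λ_{x̄} ≫ [N]`** (cf. ★ `coverLeg_comp_lam_comp_dualIsogenyOver_of_isExactTwistPol`).  PROOF:
★ organ #2 (`E : 𝒞_{x″} ≅ B` under `𝒜_{x″}`, `q′ := q ≫ E⁻¹` with its transports), ★ (ν8) applied ONCE to `q′` (with the POLARISATION `λ^{pull}` and scalar `N²` in (iv)), §1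
bookkeeping to return to `λ′` and scalar `N`. [cite: SerreTate1968, §1] [cite: BoschLutkebohmertRaynaud1990, §1.2 Prop. 8 and §7.3 Prop. 6 (p. 180)]
[cite: MumfordAV1970, §7 Thm. 4 (p. 72), §15 Thm. 1 (p. 143), §23 Thm. 2 (p. 231)] [cite: RapoportSmithlingZhang2020Diagonal, §4.3 (4.23) (p. 21)] -/
theorem exists_roofLeg_specialFibre
    (hN : N ≠ 0) (hP : E' * P = P) (hQ : Q * E' = Q)
    (hQP : Q * P = Matrix.scalar (Fin 1) (N : O)) (hPQ : P * Q = Matrix.scalar (Fin m) (N : O) * E')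
    {𝔭 : Ideal O} (h𝔭 : Ideal.span (Set.range fun k => P k 0) = 𝔭)
    -- the exact twisted polarisation (★ organ #1b) and the twisted level structure (★ `SerreTwistLevel`)
    (lam' : (serreTensor act E' hE').X ⟶ Db.hat.X) [IsMonHom lam'] (hex : IsExactTwistPol act E' hE' P D Db pol N lam')
    (hfac : ((𝟙 (serreTensor act E' hE').X) ^ N) ≫ lam' = serreTwistLamPull act E' hE' Q D Db pol)
    {g₀ n : ℕ} (lvl : 𝒜.LevelStructure g₀ n) (lvl' : (serreTensor act E' hE').LevelStructure g₀ n)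
    (hlvl : ∀ i, lvl'.σ i = lvl.σ i ≫ serreTranslate act E' hE' P)
    -- the upstairs roof at `x, x″`
    {B : AbelianSchemeOver (Spec (.of (AlgebraicClosure (v.adicCompletion K))))}
    (q : ((𝒜.baseChange (𝓨.genericIso'.inv.left ≫ pullback.fst 𝓨.total.hom (specGenericPoint (valuationSubringAtPrime K v) K))).baseChange x.left).X ⟶ B.X)
    [IsMonHom q] [IsFinite q.left] [Surjective q.left]
    (c : ((𝒜.baseChange (𝓨.genericIso'.inv.left ≫ pullback.fst 𝓨.total.hom (specGenericPoint (valuationSubringAtPrime K v) K))).baseChange x''.left).X ⟶ B.X)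
    [IsMonHom c] [Surjective c.left]
    -- (r2) the kernel of `c` on `Ω̄`-points is the `𝔭`-torsion
    (hker : ∀ Pt : ((𝒜.baseChange (𝓨.genericIso'.inv.left ≫ pullback.fst 𝓨.total.hom (specGenericPoint (valuationSubringAtPrime K v) K))).baseChange
        x''.left).toAffine.toAbelianVariety.Points (AlgebraicClosure (v.adicCompletion K)),
      (AlgPoints.map c Pt : B.toAffine.toAbelianVariety.Points (AlgebraicClosure (v.adicCompletion K))) = 1 ↔
        ∀ a ∈ 𝔭, (AlgPoints.map (((act.baseChange (𝓨.genericIso'.inv.left ≫ pullback.fst 𝓨.total.hom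
            (specGenericPoint (valuationSubringAtPrime K v) K))).baseChange x''.left).i a) Pt :
          ((𝒜.baseChange (𝓨.genericIso'.inv.left ≫ pullback.fst 𝓨.total.hom (specGenericPoint (valuationSubringAtPrime K v) K))).baseChange
            x''.left).toAffine.toAbelianVariety.Points (AlgebraicClosure (v.adicCompletion K))) = 1)
    -- (r3) the polarisation laws of the two legs through the dual homomorphism `λ_B`
    (DB : B.DualPair) (hDB : Nonempty ((Scheme.Modules.pullback (DualPair.unitHatSlice DB)).obj DB.P ≅ SheafOfModules.unit _))
    (lamB : B.X ⟶ DB.hat.X) [IsMonHom lamB]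
    (hq3 : q ≫ lamB ≫ DualPair.dualIsogenyOver q
        ((D.baseChange (𝓨.genericIso'.inv.left ≫ pullback.fst 𝓨.total.hom (specGenericPoint (valuationSubringAtPrime K v) K))).baseChange x.left) DB =
      ((pol.baseChange (𝓨.genericIso'.inv.left ≫ pullback.fst 𝓨.total.hom (specGenericPoint (valuationSubringAtPrime K v) K))).baseChange x.left).lam ≫
        ((D.baseChange (𝓨.genericIso'.inv.left ≫ pullback.fst 𝓨.total.hom (specGenericPoint (valuationSubringAtPrime K v) K))).baseChange x.left).hat.mulN N)
    (hc3 : c ≫ lamB ≫ DualPair.dualIsogenyOver c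
        ((D.baseChange (𝓨.genericIso'.inv.left ≫ pullback.fst 𝓨.total.hom (specGenericPoint (valuationSubringAtPrime K v) K))).baseChange x''.left) DB =
      ((pol.baseChange (𝓨.genericIso'.inv.left ≫ pullback.fst 𝓨.total.hom (specGenericPoint (valuationSubringAtPrime K v) K))).baseChange x''.left).lam ≫
        ((D.baseChange (𝓨.genericIso'.inv.left ≫ pullback.fst 𝓨.total.hom (specGenericPoint (valuationSubringAtPrime K v) K))).baseChange x''.left).hat.mulN N)
    -- (r4) common intertwiners
    (hb : ∀ a : O, ∃ b : B.X ⟶ B.X,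
      ((act.baseChange (𝓨.genericIso'.inv.left ≫ pullback.fst 𝓨.total.hom (specGenericPoint (valuationSubringAtPrime K v) K))).baseChange x.left).i a ≫ q =
          q ≫ b ∧
        ((act.baseChange (𝓨.genericIso'.inv.left ≫ pullback.fst 𝓨.total.hom (specGenericPoint (valuationSubringAtPrime K v) K))).baseChange x''.left).i a ≫ c =
          c ≫ b)
    -- (r5) level points correspond
    (hlev : ∀ a : Fin g₀ ⊕ Fin g₀ → ZMod n,
      (AlgPoints.map q ((𝒜.baseChange (𝓨.genericIso'.inv.left ≫ pullback.fst 𝓨.total.hom (specGenericPoint (valuationSubringAtPrime K v) K))).restrictPt x.left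
          ((lvl.baseChange (𝓨.genericIso'.inv.left ≫ pullback.fst 𝓨.total.hom (specGenericPoint (valuationSubringAtPrime K v) K))).section_ a)) :
          B.toAffine.toAbelianVariety.Points (AlgebraicClosure (v.adicCompletion K))) =
        AlgPoints.map c ((𝒜.baseChange (𝓨.genericIso'.inv.left ≫ pullback.fst 𝓨.total.hom (specGenericPoint (valuationSubringAtPrime K v) K))).restrictPt x''.left
          ((lvl.baseChange (𝓨.genericIso'.inv.left ≫ pullback.fst 𝓨.total.hom (specGenericPoint (valuationSubringAtPrime K v) K))).section_ a))) :
    ∃ (qbar : ((𝒜.baseChange (pullback.fst 𝓨.total.hom (specResidueField v))).baseChange (𝓨.geomReductionMap x).left).X ⟶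
               (((serreTensor act E' hE').baseChange (pullback.fst 𝓨.total.hom (specResidueField v))).baseChange (𝓨.geomReductionMap x'').left).X)
      (_ : IsMonHom qbar),
      -- (r1₀)
      (Flat qbar.left ∧ Function.Surjective qbar.left.base) ∧
      -- (r4₀-q)
      (∀ a : O, ((act.baseChange (pullback.fst 𝓨.total.hom (specResidueField v))).baseChange (𝓨.geomReductionMap x).left).i a ≫ qbar =
        qbar ≫ (((serreAction act E' hE').baseChange (pullback.fst 𝓨.total.hom (specResidueField v))).baseChange (𝓨.geomReductionMap x'').left).i a) ∧
      -- (r5₀-q)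
      (∀ a : Fin g₀ ⊕ Fin g₀ → ZMod n,
        AlgPoints.map qbar ((𝒜.baseChange (pullback.fst 𝓨.total.hom (specResidueField v))).restrictPt (𝓨.geomReductionMap x).left
            ((lvl.baseChange (pullback.fst 𝓨.total.hom (specResidueField v))).section_ a)) =
          ((serreTensor act E' hE').baseChange (pullback.fst 𝓨.total.hom (specResidueField v))).restrictPt (𝓨.geomReductionMap x'').left
            ((lvl'.baseChange (pullback.fst 𝓨.total.hom (specResidueField v))).section_ a)) ∧
      -- (r3₀-q)
      qbar ≫ baseChangeHom (baseChangeHom lam' (pullback.fst 𝓨.total.hom (specResidueField v))) (𝓨.geomReductionMap x'').left ≫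
          DualPair.dualIsogenyOver qbar ((D.baseChange (pullback.fst 𝓨.total.hom (specResidueField v))).baseChange (𝓨.geomReductionMap x).left)
            ((Db.baseChange (pullback.fst 𝓨.total.hom (specResidueField v))).baseChange (𝓨.geomReductionMap x'').left) =
        ((pol.baseChange (pullback.fst 𝓨.total.hom (specResidueField v))).baseChange (𝓨.geomReductionMap x).left).lam ≫
          ((D.baseChange (pullback.fst 𝓨.total.hom (specResidueField v))).baseChange (𝓨.geomReductionMap x).left).hat.mulN N := by
  haveI := isMonHom_serreTranslate act E' hE' P
  haveI := pol.isMonHom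
  haveI : CharZero (v.adicCompletion K) := charZero_of_injective_algebraMap (algebraMap K (v.adicCompletion K)).injective
  haveI : IsLocallyNoetherian (specOver K (AlgebraicClosure (v.adicCompletion K))).left :=
    inferInstanceAs (IsLocallyNoetherian (Spec (.of (AlgebraicClosure (v.adicCompletion K)))))
  haveI : IsReduced (specOver K (AlgebraicClosure (v.adicCompletion K))).left :=
    inferInstanceAs (IsReduced (Spec (.of (AlgebraicClosure (v.adicCompletion K)))))
  haveI : IsLocallyNoetherian (specOver v.asIdeal.ResidueField (geomResidueField v)).left :=
    inferInstanceAs (IsLocallyNoetherian (Spec (.of (geomResidueField v))))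
  haveI : IsReduced (specOver v.asIdeal.ResidueField (geomResidueField v)).left :=
    inferInstanceAs (IsReduced (Spec (.of (geomResidueField v))))
  -- STEP 1 (★ organ #2): the middle is the Serre-family fibre, `E : 𝒞_{x″} ≅ B` with `c̄ ≫ E = c`
  obtain ⟨E, hE, hEmon, hEinv, -⟩ := exists_iso_coverLeg_comp_eq_of_forall_points_of_charZero (𝓨.genericIso'.inv.left ≫ pullback.fst 𝓨.total.hom (specGenericPoint (valuationSubringAtPrime K v) K)) x''.left act E' hE' P Q c hN hP hQ hQP hPQ h𝔭 hker
  haveI := hEmon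
  haveI := hEinv
  -- the cover leg at the generic iterated base change and its properties (★ organ #1)
  haveI hψmon := isMonHom_coverLeg (𝓨.genericIso'.inv.left ≫ pullback.fst 𝓨.total.hom (specGenericPoint (valuationSubringAtPrime K v) K)) x''.left act E' hE' P
  haveI := flat_coverLeg_left (𝓨.genericIso'.inv.left ≫ pullback.fst 𝓨.total.hom (specGenericPoint (valuationSubringAtPrime K v) K)) x''.left act E' hE' P Q hN hP hQ hQP hPQ
  haveI := surjective_coverLeg_left (𝓨.genericIso'.inv.left ≫ pullback.fst 𝓨.total.hom (specGenericPoint (valuationSubringAtPrime K v) K)) x''.left act E' hE' P Q hN hP hQ hQP hPQ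
  haveI := isFinite_coverLeg_left (𝓨.genericIso'.inv.left ≫ pullback.fst 𝓨.total.hom (specGenericPoint (valuationSubringAtPrime K v) K)) x''.left act E' hE' P Q hN hP hQ hQP hPQ
  haveI : QuasiCompact (baseChangeHom (baseChangeHom (serreTranslate act E' hE' P) (𝓨.genericIso'.inv.left ≫ pullback.fst 𝓨.total.hom (specGenericPoint (valuationSubringAtPrime K v) K))) x''.left).left := inferInstance
  -- STEP 2: `q′ := q ≫ E⁻¹`, finite surjective
  haveI : IsFinite (q ≫ E.inv).left := isFinite_retarget_left q E
  haveI : Surjective (q ≫ E.inv).left := surjective_retarget_left q E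
  -- STEP 3 (★ (ν8)): reduce `q′`
  obtain ⟨qbar, hqmon, h1, h2, h3, h4⟩ := exists_specialFibre_hom_reduction 𝓨 𝒜 (serreTensor act E' hE') x x'' (q ≫ E.inv)
  haveI := hqmon
  refine ⟨qbar, hqmon, h1 inferInstance inferInstance, ?_, ?_, ?_⟩
  · -- (r4₀-q): common intertwiners re-target (★ organ #2) then transfer (★ (ν8)(ii))
    intro a
    haveI := act.isMonHom a
    haveI := (serreAction act E' hE').isMonHom a
    obtain ⟨b, hqb, hcb⟩ := hb a
    exact h2 (act.i a) ((serreAction act E' hE').i a)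
      (i_comp_retarget_of_common_intertwiner q c (baseChangeHom (baseChangeHom (serreTranslate act E' hE' P) (𝓨.genericIso'.inv.left ≫ pullback.fst 𝓨.total.hom (specGenericPoint (valuationSubringAtPrime K v) K))) x''.left) E hE hqb hcb
        (i_comp_coverLeg (𝓨.genericIso'.inv.left ≫ pullback.fst 𝓨.total.hom (specGenericPoint (valuationSubringAtPrime K v) K)) x''.left act E' hE' P hP a))
  · -- (r5₀-q): level points re-target (★ organ #2 + ★ organ #1 §3) then transfer (★ (ν8)(iii))
    intro a
    have hup : AlgPoints.map (q ≫ E.inv) ((𝒜.baseChange (𝓨.genericIso'.inv.left ≫ pullback.fst 𝓨.total.hom (specGenericPoint (valuationSubringAtPrime K v) K))).restrictPt x.left (𝒜.sectionBaseChange (𝓨.genericIso'.inv.left ≫ pullback.fst 𝓨.total.hom (specGenericPoint (valuationSubringAtPrime K v) K)) (lvl.section_ a))) =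
        ((serreTensor act E' hE').baseChange (𝓨.genericIso'.inv.left ≫ pullback.fst 𝓨.total.hom (specGenericPoint (valuationSubringAtPrime K v) K))).restrictPt x''.left ((serreTensor act E' hE').sectionBaseChange (𝓨.genericIso'.inv.left ≫ pullback.fst 𝓨.total.hom (specGenericPoint (valuationSubringAtPrime K v) K)) (lvl'.section_ a)) := by
      rw [← LevelStructure.baseChange_section_, ← LevelStructure.baseChange_section_,
        map_retarget_eq_map q c (baseChangeHom (baseChangeHom (serreTranslate act E' hE' P) (𝓨.genericIso'.inv.left ≫ pullback.fst 𝓨.total.hom (specGenericPoint (valuationSubringAtPrime K v) K))) x''.left) E hE _ _ (hlev a)]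
      exact map_coverLeg_restrictPt_section (𝓨.genericIso'.inv.left ≫ pullback.fst 𝓨.total.hom (specGenericPoint (valuationSubringAtPrime K v) K)) x''.left act E' hE' P lvl lvl' hlvl a
    have h := h3 (lvl.section_ a) (lvl'.section_ a) hup
    rw [← LevelStructure.baseChange_section_, ← LevelStructure.baseChange_section_] at h
    exact h
  · -- (r3₀-q): through the POLARISATION `λ^{pull}` with scalar `N²`, then divide by `N` downstairs
    -- upstairs: `q′^*λ′_{x″} = N·λ_x` (★ organ #2, with ★ organ #1 §3 for the c̄-law and ★ organ #2 §2 for the dual quasi-inverse)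
    have hDbη := DualPair.nonempty_unitHatSlice_baseChange_iso (g := x''.left) _ (DualPair.nonempty_unitHatSlice_baseChange_iso (g := (𝓨.genericIso'.inv.left ≫ pullback.fst 𝓨.total.hom (specGenericPoint (valuationSubringAtPrime K v) K))) Db hDb)
    have hDηx := DualPair.nonempty_unitHatSlice_baseChange_iso (g := x.left) _ (DualPair.nonempty_unitHatSlice_baseChange_iso (g := (𝓨.genericIso'.inv.left ≫ pullback.fst 𝓨.total.hom (specGenericPoint (valuationSubringAtPrime K v) K))) D hD)
    haveI : IsMonHom (baseChangeHom (baseChangeHom lam' (𝓨.genericIso'.inv.left ≫ pullback.fst 𝓨.total.hom (specGenericPoint (valuationSubringAtPrime K v) K))) x''.left) := (haveI := isMonHom_baseChangeHom lam' (𝓨.genericIso'.inv.left ≫ pullback.fst 𝓨.total.hom (specGenericPoint (valuationSubringAtPrime K v) K)); isMonHom_baseChangeHom _ x''.left)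
    have hψl := coverLeg_comp_lam_comp_dualIsogenyOver_of_isExactTwistPol (𝓨.genericIso'.inv.left ≫ pullback.fst 𝓨.total.hom (specGenericPoint (valuationSubringAtPrime K v) K)) act E' hE' P x''.left D Db pol hex
    have hup : (q ≫ E.inv) ≫ baseChangeHom (baseChangeHom lam' (𝓨.genericIso'.inv.left ≫ pullback.fst 𝓨.total.hom (specGenericPoint (valuationSubringAtPrime K v) K))) x''.left ≫
        DualPair.dualIsogenyOver (q ≫ E.inv) ((D.baseChange (𝓨.genericIso'.inv.left ≫ pullback.fst 𝓨.total.hom (specGenericPoint (valuationSubringAtPrime K v) K))).baseChange x.left) ((Db.baseChange (𝓨.genericIso'.inv.left ≫ pullback.fst 𝓨.total.hom (specGenericPoint (valuationSubringAtPrime K v) K))).baseChange x''.left) =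
        ((pol.baseChange (𝓨.genericIso'.inv.left ≫ pullback.fst 𝓨.total.hom (specGenericPoint (valuationSubringAtPrime K v) K))).baseChange x.left).lam ≫ ((D.baseChange (𝓨.genericIso'.inv.left ≫ pullback.fst 𝓨.total.hom (specGenericPoint (valuationSubringAtPrime K v) K))).baseChange x.left).hat.mulN N := by
      haveI : IsMonHom (baseChangeHom (baseChangeHom (serreTranslateInv act E' hE' Q) (𝓨.genericIso'.inv.left ≫ pullback.fst 𝓨.total.hom (specGenericPoint (valuationSubringAtPrime K v) K))) x''.left) :=
        (haveI := isMonHom_serreTranslateInv act E' hE' Q; haveI := isMonHom_baseChangeHom (serreTranslateInv act E' hE' Q) (𝓨.genericIso'.inv.left ≫ pullback.fst 𝓨.total.hom (specGenericPoint (valuationSubringAtPrime K v) K));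
          isMonHom_baseChangeHom _ x''.left)
      refine retarget_comp_lam_comp_dualIsogenyOver q c (baseChangeHom (baseChangeHom (serreTranslate act E' hE' P) (𝓨.genericIso'.inv.left ≫ pullback.fst 𝓨.total.hom (specGenericPoint (valuationSubringAtPrime K v) K))) x''.left) E
        ((D.baseChange (𝓨.genericIso'.inv.left ≫ pullback.fst 𝓨.total.hom (specGenericPoint (valuationSubringAtPrime K v) K))).baseChange x.left) ((D.baseChange (𝓨.genericIso'.inv.left ≫ pullback.fst 𝓨.total.hom (specGenericPoint (valuationSubringAtPrime K v) K))).baseChange x''.left) DB ((Db.baseChange (𝓨.genericIso'.inv.left ≫ pullback.fst 𝓨.total.hom (specGenericPoint (valuationSubringAtPrime K v) K))).baseChange x''.left) hDB hDbη hE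
        ((pol.baseChange (𝓨.genericIso'.inv.left ≫ pullback.fst 𝓨.total.hom (specGenericPoint (valuationSubringAtPrime K v) K))).baseChange x.left).lam ((pol.baseChange (𝓨.genericIso'.inv.left ≫ pullback.fst 𝓨.total.hom (specGenericPoint (valuationSubringAtPrime K v) K))).baseChange x''.left).lam lamB (baseChangeHom (baseChangeHom lam' (𝓨.genericIso'.inv.left ≫ pullback.fst 𝓨.total.hom (specGenericPoint (valuationSubringAtPrime K v) K))) x''.left)
        (DualPair.dualIsogenyOver (baseChangeHom (baseChangeHom (serreTranslateInv act E' hE' Q) (𝓨.genericIso'.inv.left ≫ pullback.fst 𝓨.total.hom (specGenericPoint (valuationSubringAtPrime K v) K))) x''.left)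
          ((Db.baseChange (𝓨.genericIso'.inv.left ≫ pullback.fst 𝓨.total.hom (specGenericPoint (valuationSubringAtPrime K v) K))).baseChange x''.left) ((D.baseChange (𝓨.genericIso'.inv.left ≫ pullback.fst 𝓨.total.hom (specGenericPoint (valuationSubringAtPrime K v) K))).baseChange x''.left))
        hN (dualIsogenyOver_coverLeg_comp_eq_pow_id (𝓨.genericIso'.inv.left ≫ pullback.fst 𝓨.total.hom (specGenericPoint (valuationSubringAtPrime K v) K)) x''.left act E' hE' P Q hP hQ hPQ _ _ hDbη) hq3 hc3 ?_
      simpa only [Polarization.baseChange_lam] using hψl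
    -- multiply by `N`: the law for the POLARISATION `λ^{pull}` with scalar `N²`
    have hpullη : baseChangeHom (baseChangeHom (serreTwistLamPull act E' hE' Q D Db pol) (𝓨.genericIso'.inv.left ≫ pullback.fst 𝓨.total.hom (specGenericPoint (valuationSubringAtPrime K v) K))) x''.left =
        baseChangeHom (baseChangeHom lam' (𝓨.genericIso'.inv.left ≫ pullback.fst 𝓨.total.hom (specGenericPoint (valuationSubringAtPrime K v) K))) x''.left ≫ ((Db.baseChange (𝓨.genericIso'.inv.left ≫ pullback.fst 𝓨.total.hom (specGenericPoint (valuationSubringAtPrime K v) K))).baseChange x''.left).hat.mulN N :=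
      baseChangeHom_baseChangeHom_of_pow_id_comp_eq Db lam' (𝓨.genericIso'.inv.left ≫ pullback.fst 𝓨.total.hom (specGenericPoint (valuationSubringAtPrime K v) K)) x''.left _ hfac
    have hup2 := comp_comp_mulN_comp_dualIsogenyOver ((D.baseChange (𝓨.genericIso'.inv.left ≫ pullback.fst 𝓨.total.hom (specGenericPoint (valuationSubringAtPrime K v) K))).baseChange x.left) ((Db.baseChange (𝓨.genericIso'.inv.left ≫ pullback.fst 𝓨.total.hom (specGenericPoint (valuationSubringAtPrime K v) K))).baseChange x''.left) hDηx hDbη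
      (q ≫ E.inv) ((pol.baseChange (𝓨.genericIso'.inv.left ≫ pullback.fst 𝓨.total.hom (specGenericPoint (valuationSubringAtPrime K v) K))).baseChange x.left).lam (baseChangeHom (baseChangeHom lam' (𝓨.genericIso'.inv.left ≫ pullback.fst 𝓨.total.hom (specGenericPoint (valuationSubringAtPrime K v) K))) x''.left) N hup
    rw [← hpullη] at hup2
    -- transfer (★ (ν8)(iv)) for the polarisation `serreTwistPolPull`
    have h := h4 D pol Db (serreTwistPolPull act E' hE' P Q D Db hD hDb pol hN hP hQ hQP hPQ) (N * N) (by
      rw [Polarization.baseChange_lam, Polarization.baseChange_lam, serreTwistPolPull_lam]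
      exact hup2)
    -- divide by `N` downstairs
    have hDbs := DualPair.nonempty_unitHatSlice_baseChange_iso (g := (𝓨.geomReductionMap x'').left) _
      (DualPair.nonempty_unitHatSlice_baseChange_iso (g := (pullback.fst 𝓨.total.hom (specResidueField v))) Db hDb)
    have hDs := DualPair.nonempty_unitHatSlice_baseChange_iso (g := (𝓨.geomReductionMap x).left) _
      (DualPair.nonempty_unitHatSlice_baseChange_iso (g := (pullback.fst 𝓨.total.hom (specResidueField v))) D hD)
    have hpulls : baseChangeHom (baseChangeHom (serreTwistLamPull act E' hE' Q D Db pol) (pullback.fst 𝓨.total.hom (specResidueField v))) (𝓨.geomReductionMap x'').left =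
        baseChangeHom (baseChangeHom lam' (pullback.fst 𝓨.total.hom (specResidueField v))) (𝓨.geomReductionMap x'').left ≫ ((Db.baseChange (pullback.fst 𝓨.total.hom (specResidueField v))).baseChange (𝓨.geomReductionMap x'').left).hat.mulN N :=
      baseChangeHom_baseChangeHom_of_pow_id_comp_eq Db lam' (pullback.fst 𝓨.total.hom (specResidueField v)) (𝓨.geomReductionMap x'').left _ hfac
    rw [Polarization.baseChange_lam, Polarization.baseChange_lam, serreTwistPolPull_lam] at h
    change qbar ≫ baseChangeHom (baseChangeHom (serreTwistLamPull act E' hE' Q D Db pol) (pullback.fst 𝓨.total.hom (specResidueField v))) (𝓨.geomReductionMap x'').left ≫ _ = _ at h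
    rw [hpulls] at h
    haveI : IsMonHom (baseChangeHom (baseChangeHom lam' (pullback.fst 𝓨.total.hom (specResidueField v))) (𝓨.geomReductionMap x'').left) :=
      (haveI := isMonHom_baseChangeHom lam' (pullback.fst 𝓨.total.hom (specResidueField v)); isMonHom_baseChangeHom _ (𝓨.geomReductionMap x'').left)
    haveI := ((pol.baseChange (pullback.fst 𝓨.total.hom (specResidueField v))).baseChange (𝓨.geomReductionMap x).left).isMonHom
    have hfin := comp_lam_comp_dualIsogenyOver_of_comp_mulN ((D.baseChange (pullback.fst 𝓨.total.hom (specResidueField v))).baseChange (𝓨.geomReductionMap x).left)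
      ((Db.baseChange (pullback.fst 𝓨.total.hom (specResidueField v))).baseChange (𝓨.geomReductionMap x'').left) hDs hDbs qbar ((pol.baseChange (pullback.fst 𝓨.total.hom (specResidueField v))).baseChange (𝓨.geomReductionMap x).left).lam
      (baseChangeHom (baseChangeHom lam' (pullback.fst 𝓨.total.hom (specResidueField v))) (𝓨.geomReductionMap x'').left) hN h
    rw [Polarization.baseChange_lam, Polarization.baseChange_lam] at hfin ⊢
    exact hfin

end Head

/-! ## §3 (ED. 2) Sections editions: the cover leg carries `τ` to `τ ≫ ψ_P`; the legs head without a twisted level structure -/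

section SectionsCover

variable {Y Y' : Scheme.{u}} (g : Y' ⟶ Y) {Ω : Type u} [Field Ω] (x : Spec (.of Ω) ⟶ Y') {A : AbelianSchemeOver Y} {O : Type*} [CommRing O]
  (act : A.RingAction O) [IsCommMonObj A.X] {m : ℕ} (E' : Matrix (Fin m) (Fin m) O) (hE' : E' * E' = E') (P : Matrix (Fin m) (Fin 1) O)

/-- **(r5₀-c), sections edition**: the cover leg `c̄ = (ψ_P ×_Y Y′) ×_{Y′} x` carries the point `(τ ×_Y Y′)(x)` of a section `τ` of `𝒜` to the point of the section
`τ ≫ ψ_P` of `𝒞` (★ `map_fibreHom_restrictPt`, ★ `sectionBaseChange_comp`) — the partner of `exists_roofLeg_specialFibre_sections`' level clause, so that `Roof₀` (r5₀)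
`q̄(σ^a(x̄)) = c̄(σ^a(x̄″))` follows by transitivity with `τ := lvl.section_ a` (`(lvl ×_Y Y′).section_ a = (lvl.section_ a) ×_Y Y′`, ★ `LevelStructure.baseChange_section_`).
[cite: MumfordFogartyKirwan1994, Ch. 7 §2 Definition 7.2 (p. 129)] -/
theorem map_coverLeg_restrictPt_sectionBaseChange (τ : A.Sections) :
    AlgPoints.map (baseChangeHom (baseChangeHom (serreTranslate act E' hE' P) g) x) ((A.baseChange g).restrictPt x (A.sectionBaseChange g τ)) =
      ((serreTensor act E' hE').baseChange g).restrictPt x ((serreTensor act E' hE').sectionBaseChange g (τ ≫ serreTranslate act E' hE' P)) := by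
  haveI := isMonHom_serreTranslate act E' hE' P
  haveI := isMonHom_baseChangeHom (serreTranslate act E' hE' P) g
  rw [sectionBaseChange_comp, ← map_fibreHom_restrictPt x (baseChangeHom (serreTranslate act E' hE' P) g)]
  rfl

end SectionsCover

section HeadSections

variable {K : Type} [Field K] [NumberField K] {v : HeightOneSpectrum (𝓞 K)} {Y : SchemeOver K}
  (𝓨 : IntegralModel (valuationSubringAtPrime K v) K Y) [IsProper 𝓨.total.hom] [IsReduced 𝓨.total.left] [IsLocallyNoetherian 𝓨.total.left]
  {𝒜 : AbelianSchemeOver 𝓨.total.left} {O : Type*} [CommRing O] (act : 𝒜.RingAction O) [IsCommMonObj 𝒜.X]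
  {m : ℕ} (E' : Matrix (Fin m) (Fin m) O) (hE' : E' * E' = E') (P : Matrix (Fin m) (Fin 1) O) (Q : Matrix (Fin 1) (Fin m) O) {N : ℕ}
  (x x'' : AlgPoints Y (AlgebraicClosure (v.adicCompletion K)))
  (D : 𝒜.DualPair) (Db : (serreTensor act E' hE').DualPair)
  (hD : Nonempty ((Scheme.Modules.pullback (DualPair.unitHatSlice D)).obj D.P ≅ SheafOfModules.unit _))
  (hDb : Nonempty ((Scheme.Modules.pullback (DualPair.unitHatSlice Db)).obj Db.P ≅ SheafOfModules.unit _))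
  (pol : 𝒜.Polarization D)

include hD hDb in
set_option maxHeartbeats 400000 in
/-- **THE LEGS OF THE DOWNSTAIRS ROOF — SECTIONS EDITION (ED. 2)**: as `exists_roofLeg_specialFibre`, with the level clause stated for an ARBITRARY family of sections
`τ : J → 𝒜.Sections` and the `𝒞`-side read as `τ i ≫ ψ_P` (no twisted `LevelStructure` on `𝒞`, hence no coprimality of the level with `N` is needed: the P6a `Roof₀` (r5₀)
`q̄(σ^a(x̄)) = c̄(σ^a(x̄″))` gives `B` no level structure).  Original docstring:  In the setting of the module docstring (`𝓨` proper model at `v`; `𝒜 → 𝓨` commutative with `𝒪`-action and Serre data presenting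
`𝔟 ≅ 𝔭⁻¹`; `𝒞 = 𝒜 ⊗ 𝔟`; exact twisted `λ′` with `[N] ≫ λ′ = λ^{pull}`; `lvl′.σ i = lvl.σ i ≫ ψ_P`), from an UPSTAIRS roof `𝒜_x —q→ B ←c— 𝒜_{x″}` at `x, x″ ∈ Y(Ω̄)` with
`q` finite surjective, `c` surjective with `Ker c(Ω̄) = 𝒜_{x″}[𝔭](Ω̄)` on `Ω̄`-points, a dual homomorphism `λ_B` with `q^*λ_B = N·λ_x` and `c^*λ_B = N·λ_{x″}`, common intertwiners and
matching level points, THERE IS a homomorphism **`q̄ : (𝒜 ×_𝓨 𝓨_s)_{x̄} → (𝒞 ×_𝓨 𝓨_s)_{x̄″}`** (`x̄ = red x`, `x̄″ = red x″`) which is (r1₀) FLAT and SURJECTIVE, (r4₀-q) `ι`-EQUIVARIANT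
(`ι_{x̄}(a) ≫ q̄ = q̄ ≫ ι^𝒞_{x̄″}(a)`, the common endomorphism being the Serre action — cf. ★ `i_comp_coverLeg` for `c̄`), (r5₀-q) carries `σ^a(x̄)` to `σ_𝒞^a(x̄″)` (cf. ★
`map_coverLeg_restrictPt_section`), and (r3₀-q) satisfies **`q̄ ≫ λ′_{x̄″} ≫ q̄^∨ = λ_{x̄} ≫ [N]`** (cf. ★ `coverLeg_comp_lam_comp_dualIsogenyOver_of_isExactTwistPol`).  PROOF:
★ organ #2 (`E : 𝒞_{x″} ≅ B` under `𝒜_{x″}`, `q′ := q ≫ E⁻¹` with its transports), ★ (ν8) applied ONCE to `q′` (with the POLARISATION `λ^{pull}` and scalar `N²` in (iv)), §1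
bookkeeping to return to `λ′` and scalar `N`. [cite: SerreTate1968, §1] [cite: BoschLutkebohmertRaynaud1990, §1.2 Prop. 8 and §7.3 Prop. 6 (p. 180)]
[cite: MumfordAV1970, §7 Thm. 4 (p. 72), §15 Thm. 1 (p. 143), §23 Thm. 2 (p. 231)] [cite: RapoportSmithlingZhang2020Diagonal, §4.3 (4.23) (p. 21)] -/
theorem exists_roofLeg_specialFibre_sections
    (hN : N ≠ 0) (hP : E' * P = P) (hQ : Q * E' = Q)
    (hQP : Q * P = Matrix.scalar (Fin 1) (N : O)) (hPQ : P * Q = Matrix.scalar (Fin m) (N : O) * E')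
    {𝔭 : Ideal O} (h𝔭 : Ideal.span (Set.range fun k => P k 0) = 𝔭)
    -- the exact twisted polarisation (★ organ #1b) and the twisted level structure (★ `SerreTwistLevel`)
    (lam' : (serreTensor act E' hE').X ⟶ Db.hat.X) [IsMonHom lam'] (hex : IsExactTwistPol act E' hE' P D Db pol N lam')
    (hfac : ((𝟙 (serreTensor act E' hE').X) ^ N) ≫ lam' = serreTwistLamPull act E' hE' Q D Db pol)
    {J : Type*} (τ : J → 𝒜.Sections)
    -- the upstairs roof at `x, x″`
    {B : AbelianSchemeOver (Spec (.of (AlgebraicClosure (v.adicCompletion K))))}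
    (q : ((𝒜.baseChange (𝓨.genericIso'.inv.left ≫ pullback.fst 𝓨.total.hom (specGenericPoint (valuationSubringAtPrime K v) K))).baseChange x.left).X ⟶ B.X)
    [IsMonHom q] [IsFinite q.left] [Surjective q.left]
    (c : ((𝒜.baseChange (𝓨.genericIso'.inv.left ≫ pullback.fst 𝓨.total.hom (specGenericPoint (valuationSubringAtPrime K v) K))).baseChange x''.left).X ⟶ B.X)
    [IsMonHom c] [Surjective c.left]
    -- (r2) the kernel of `c` on `Ω̄`-points is the `𝔭`-torsion
    (hker : ∀ Pt : ((𝒜.baseChange (𝓨.genericIso'.inv.left ≫ pullback.fst 𝓨.total.hom (specGenericPoint (valuationSubringAtPrime K v) K))).baseChange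
        x''.left).toAffine.toAbelianVariety.Points (AlgebraicClosure (v.adicCompletion K)),
      (AlgPoints.map c Pt : B.toAffine.toAbelianVariety.Points (AlgebraicClosure (v.adicCompletion K))) = 1 ↔
        ∀ a ∈ 𝔭, (AlgPoints.map (((act.baseChange (𝓨.genericIso'.inv.left ≫ pullback.fst 𝓨.total.hom
            (specGenericPoint (valuationSubringAtPrime K v) K))).baseChange x''.left).i a) Pt :
          ((𝒜.baseChange (𝓨.genericIso'.inv.left ≫ pullback.fst 𝓨.total.hom (specGenericPoint (valuationSubringAtPrime K v) K))).baseChange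
            x''.left).toAffine.toAbelianVariety.Points (AlgebraicClosure (v.adicCompletion K))) = 1)
    -- (r3) the polarisation laws of the two legs through the dual homomorphism `λ_B`
    (DB : B.DualPair) (hDB : Nonempty ((Scheme.Modules.pullback (DualPair.unitHatSlice DB)).obj DB.P ≅ SheafOfModules.unit _))
    (lamB : B.X ⟶ DB.hat.X) [IsMonHom lamB]
    (hq3 : q ≫ lamB ≫ DualPair.dualIsogenyOver q
        ((D.baseChange (𝓨.genericIso'.inv.left ≫ pullback.fst 𝓨.total.hom (specGenericPoint (valuationSubringAtPrime K v) K))).baseChange x.left) DB =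
      ((pol.baseChange (𝓨.genericIso'.inv.left ≫ pullback.fst 𝓨.total.hom (specGenericPoint (valuationSubringAtPrime K v) K))).baseChange x.left).lam ≫
        ((D.baseChange (𝓨.genericIso'.inv.left ≫ pullback.fst 𝓨.total.hom (specGenericPoint (valuationSubringAtPrime K v) K))).baseChange x.left).hat.mulN N)
    (hc3 : c ≫ lamB ≫ DualPair.dualIsogenyOver c
        ((D.baseChange (𝓨.genericIso'.inv.left ≫ pullback.fst 𝓨.total.hom (specGenericPoint (valuationSubringAtPrime K v) K))).baseChange x''.left) DB =
      ((pol.baseChange (𝓨.genericIso'.inv.left ≫ pullback.fst 𝓨.total.hom (specGenericPoint (valuationSubringAtPrime K v) K))).baseChange x''.left).lam ≫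
        ((D.baseChange (𝓨.genericIso'.inv.left ≫ pullback.fst 𝓨.total.hom (specGenericPoint (valuationSubringAtPrime K v) K))).baseChange x''.left).hat.mulN N)
    -- (r4) common intertwiners
    (hb : ∀ a : O, ∃ b : B.X ⟶ B.X,
      ((act.baseChange (𝓨.genericIso'.inv.left ≫ pullback.fst 𝓨.total.hom (specGenericPoint (valuationSubringAtPrime K v) K))).baseChange x.left).i a ≫ q =
          q ≫ b ∧
        ((act.baseChange (𝓨.genericIso'.inv.left ≫ pullback.fst 𝓨.total.hom (specGenericPoint (valuationSubringAtPrime K v) K))).baseChange x''.left).i a ≫ c =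
          c ≫ b)
    -- (r5) level points correspond
    (hlev : ∀ i : J,
      (AlgPoints.map q ((𝒜.baseChange (𝓨.genericIso'.inv.left ≫ pullback.fst 𝓨.total.hom (specGenericPoint (valuationSubringAtPrime K v) K))).restrictPt x.left
          (𝒜.sectionBaseChange (𝓨.genericIso'.inv.left ≫ pullback.fst 𝓨.total.hom (specGenericPoint (valuationSubringAtPrime K v) K)) (τ i))) :
          B.toAffine.toAbelianVariety.Points (AlgebraicClosure (v.adicCompletion K))) =
        AlgPoints.map c ((𝒜.baseChange (𝓨.genericIso'.inv.left ≫ pullback.fst 𝓨.total.hom (specGenericPoint (valuationSubringAtPrime K v) K))).restrictPt x''.left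
          (𝒜.sectionBaseChange (𝓨.genericIso'.inv.left ≫ pullback.fst 𝓨.total.hom (specGenericPoint (valuationSubringAtPrime K v) K)) (τ i)))) :
    ∃ (qbar : ((𝒜.baseChange (pullback.fst 𝓨.total.hom (specResidueField v))).baseChange (𝓨.geomReductionMap x).left).X ⟶
               (((serreTensor act E' hE').baseChange (pullback.fst 𝓨.total.hom (specResidueField v))).baseChange (𝓨.geomReductionMap x'').left).X)
      (_ : IsMonHom qbar),
      -- (r1₀)
      (Flat qbar.left ∧ Function.Surjective qbar.left.base) ∧
      -- (r4₀-q)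
      (∀ a : O, ((act.baseChange (pullback.fst 𝓨.total.hom (specResidueField v))).baseChange (𝓨.geomReductionMap x).left).i a ≫ qbar =
        qbar ≫ (((serreAction act E' hE').baseChange (pullback.fst 𝓨.total.hom (specResidueField v))).baseChange (𝓨.geomReductionMap x'').left).i a) ∧
      -- (r5₀-q)
      (∀ i : J,
        AlgPoints.map qbar ((𝒜.baseChange (pullback.fst 𝓨.total.hom (specResidueField v))).restrictPt (𝓨.geomReductionMap x).left
            (𝒜.sectionBaseChange (pullback.fst 𝓨.total.hom (specResidueField v)) (τ i))) =
          ((serreTensor act E' hE').baseChange (pullback.fst 𝓨.total.hom (specResidueField v))).restrictPt (𝓨.geomReductionMap x'').left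
            ((serreTensor act E' hE').sectionBaseChange (pullback.fst 𝓨.total.hom (specResidueField v)) (τ i ≫ serreTranslate act E' hE' P))) ∧
      -- (r3₀-q)
      qbar ≫ baseChangeHom (baseChangeHom lam' (pullback.fst 𝓨.total.hom (specResidueField v))) (𝓨.geomReductionMap x'').left ≫
          DualPair.dualIsogenyOver qbar ((D.baseChange (pullback.fst 𝓨.total.hom (specResidueField v))).baseChange (𝓨.geomReductionMap x).left)
            ((Db.baseChange (pullback.fst 𝓨.total.hom (specResidueField v))).baseChange (𝓨.geomReductionMap x'').left) =
        ((pol.baseChange (pullback.fst 𝓨.total.hom (specResidueField v))).baseChange (𝓨.geomReductionMap x).left).lam ≫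
          ((D.baseChange (pullback.fst 𝓨.total.hom (specResidueField v))).baseChange (𝓨.geomReductionMap x).left).hat.mulN N := by
  haveI := isMonHom_serreTranslate act E' hE' P
  haveI := pol.isMonHom
  haveI : CharZero (v.adicCompletion K) := charZero_of_injective_algebraMap (algebraMap K (v.adicCompletion K)).injective
  haveI : IsLocallyNoetherian (specOver K (AlgebraicClosure (v.adicCompletion K))).left :=
    inferInstanceAs (IsLocallyNoetherian (Spec (.of (AlgebraicClosure (v.adicCompletion K)))))
  haveI : IsReduced (specOver K (AlgebraicClosure (v.adicCompletion K))).left :=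
    inferInstanceAs (IsReduced (Spec (.of (AlgebraicClosure (v.adicCompletion K)))))
  haveI : IsLocallyNoetherian (specOver v.asIdeal.ResidueField (geomResidueField v)).left :=
    inferInstanceAs (IsLocallyNoetherian (Spec (.of (geomResidueField v))))
  haveI : IsReduced (specOver v.asIdeal.ResidueField (geomResidueField v)).left :=
    inferInstanceAs (IsReduced (Spec (.of (geomResidueField v))))
  -- STEP 1 (★ organ #2): the middle is the Serre-family fibre, `E : 𝒞_{x″} ≅ B` with `c̄ ≫ E = c`
  obtain ⟨E, hE, hEmon, hEinv, -⟩ := exists_iso_coverLeg_comp_eq_of_forall_points_of_charZero (𝓨.genericIso'.inv.left ≫ pullback.fst 𝓨.total.hom (specGenericPoint (valuationSubringAtPrime K v) K)) x''.left act E' hE' P Q c hN hP hQ hQP hPQ h𝔭 hker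
  haveI := hEmon
  haveI := hEinv
  -- the cover leg at the generic iterated base change and its properties (★ organ #1)
  haveI hψmon := isMonHom_coverLeg (𝓨.genericIso'.inv.left ≫ pullback.fst 𝓨.total.hom (specGenericPoint (valuationSubringAtPrime K v) K)) x''.left act E' hE' P
  haveI := flat_coverLeg_left (𝓨.genericIso'.inv.left ≫ pullback.fst 𝓨.total.hom (specGenericPoint (valuationSubringAtPrime K v) K)) x''.left act E' hE' P Q hN hP hQ hQP hPQ
  haveI := surjective_coverLeg_left (𝓨.genericIso'.inv.left ≫ pullback.fst 𝓨.total.hom (specGenericPoint (valuationSubringAtPrime K v) K)) x''.left act E' hE' P Q hN hP hQ hQP hPQ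
  haveI := isFinite_coverLeg_left (𝓨.genericIso'.inv.left ≫ pullback.fst 𝓨.total.hom (specGenericPoint (valuationSubringAtPrime K v) K)) x''.left act E' hE' P Q hN hP hQ hQP hPQ
  haveI : QuasiCompact (baseChangeHom (baseChangeHom (serreTranslate act E' hE' P) (𝓨.genericIso'.inv.left ≫ pullback.fst 𝓨.total.hom (specGenericPoint (valuationSubringAtPrime K v) K))) x''.left).left := inferInstance
  -- STEP 2: `q′ := q ≫ E⁻¹`, finite surjective
  haveI : IsFinite (q ≫ E.inv).left := isFinite_retarget_left q E
  haveI : Surjective (q ≫ E.inv).left := surjective_retarget_left q E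
  -- STEP 3 (★ (ν8)): reduce `q′`
  obtain ⟨qbar, hqmon, h1, h2, h3, h4⟩ := exists_specialFibre_hom_reduction 𝓨 𝒜 (serreTensor act E' hE') x x'' (q ≫ E.inv)
  haveI := hqmon
  refine ⟨qbar, hqmon, h1 inferInstance inferInstance, ?_, ?_, ?_⟩
  · -- (r4₀-q): common intertwiners re-target (★ organ #2) then transfer (★ (ν8)(ii))
    intro a
    haveI := act.isMonHom a
    haveI := (serreAction act E' hE').isMonHom a
    obtain ⟨b, hqb, hcb⟩ := hb a
    exact h2 (act.i a) ((serreAction act E' hE').i a)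
      (i_comp_retarget_of_common_intertwiner q c (baseChangeHom (baseChangeHom (serreTranslate act E' hE' P) (𝓨.genericIso'.inv.left ≫ pullback.fst 𝓨.total.hom (specGenericPoint (valuationSubringAtPrime K v) K))) x''.left) E hE hqb hcb
        (i_comp_coverLeg (𝓨.genericIso'.inv.left ≫ pullback.fst 𝓨.total.hom (specGenericPoint (valuationSubringAtPrime K v) K)) x''.left act E' hE' P hP a))
  · -- (r5₀-q): point identities re-target (★ organ #2) then transfer (★ (ν8)(iii)) — sections edition
    intro i
    have hup : AlgPoints.map (q ≫ E.inv) ((𝒜.baseChange (𝓨.genericIso'.inv.left ≫ pullback.fst 𝓨.total.hom (specGenericPoint (valuationSubringAtPrime K v) K))).restrictPt x.left (𝒜.sectionBaseChange (𝓨.genericIso'.inv.left ≫ pullback.fst 𝓨.total.hom (specGenericPoint (valuationSubringAtPrime K v) K)) (τ i))) =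
        ((serreTensor act E' hE').baseChange (𝓨.genericIso'.inv.left ≫ pullback.fst 𝓨.total.hom (specGenericPoint (valuationSubringAtPrime K v) K))).restrictPt x''.left
          ((serreTensor act E' hE').sectionBaseChange (𝓨.genericIso'.inv.left ≫ pullback.fst 𝓨.total.hom (specGenericPoint (valuationSubringAtPrime K v) K)) (τ i ≫ serreTranslate act E' hE' P)) := by
      rw [map_retarget_eq_map q c (baseChangeHom (baseChangeHom (serreTranslate act E' hE' P) (𝓨.genericIso'.inv.left ≫ pullback.fst 𝓨.total.hom (specGenericPoint (valuationSubringAtPrime K v) K))) x''.left) E hE _ _ (hlev i),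
        sectionBaseChange_comp, ← map_fibreHom_restrictPt x''.left (baseChangeHom (serreTranslate act E' hE' P) (𝓨.genericIso'.inv.left ≫ pullback.fst 𝓨.total.hom (specGenericPoint (valuationSubringAtPrime K v) K)))]
      rfl
    exact h3 (τ i) (τ i ≫ serreTranslate act E' hE' P) hup
  · -- (r3₀-q): through the POLARISATION `λ^{pull}` with scalar `N²`, then divide by `N` downstairs
    -- upstairs: `q′^*λ′_{x″} = N·λ_x` (★ organ #2, with ★ organ #1 §3 for the c̄-law and ★ organ #2 §2 for the dual quasi-inverse)
    have hDbη := DualPair.nonempty_unitHatSlice_baseChange_iso (g := x''.left) _ (DualPair.nonempty_unitHatSlice_baseChange_iso (g := (𝓨.genericIso'.inv.left ≫ pullback.fst 𝓨.total.hom (specGenericPoint (valuationSubringAtPrime K v) K))) Db hDb)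
    have hDηx := DualPair.nonempty_unitHatSlice_baseChange_iso (g := x.left) _ (DualPair.nonempty_unitHatSlice_baseChange_iso (g := (𝓨.genericIso'.inv.left ≫ pullback.fst 𝓨.total.hom (specGenericPoint (valuationSubringAtPrime K v) K))) D hD)
    haveI : IsMonHom (baseChangeHom (baseChangeHom lam' (𝓨.genericIso'.inv.left ≫ pullback.fst 𝓨.total.hom (specGenericPoint (valuationSubringAtPrime K v) K))) x''.left) := (haveI := isMonHom_baseChangeHom lam' (𝓨.genericIso'.inv.left ≫ pullback.fst 𝓨.total.hom (specGenericPoint (valuationSubringAtPrime K v) K)); isMonHom_baseChangeHom _ x''.left)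
    have hψl := coverLeg_comp_lam_comp_dualIsogenyOver_of_isExactTwistPol (𝓨.genericIso'.inv.left ≫ pullback.fst 𝓨.total.hom (specGenericPoint (valuationSubringAtPrime K v) K)) act E' hE' P x''.left D Db pol hex
    have hup : (q ≫ E.inv) ≫ baseChangeHom (baseChangeHom lam' (𝓨.genericIso'.inv.left ≫ pullback.fst 𝓨.total.hom (specGenericPoint (valuationSubringAtPrime K v) K))) x''.left ≫
        DualPair.dualIsogenyOver (q ≫ E.inv) ((D.baseChange (𝓨.genericIso'.inv.left ≫ pullback.fst 𝓨.total.hom (specGenericPoint (valuationSubringAtPrime K v) K))).baseChange x.left) ((Db.baseChange (𝓨.genericIso'.inv.left ≫ pullback.fst 𝓨.total.hom (specGenericPoint (valuationSubringAtPrime K v) K))).baseChange x''.left) =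
        ((pol.baseChange (𝓨.genericIso'.inv.left ≫ pullback.fst 𝓨.total.hom (specGenericPoint (valuationSubringAtPrime K v) K))).baseChange x.left).lam ≫ ((D.baseChange (𝓨.genericIso'.inv.left ≫ pullback.fst 𝓨.total.hom (specGenericPoint (valuationSubringAtPrime K v) K))).baseChange x.left).hat.mulN N := by
      haveI : IsMonHom (baseChangeHom (baseChangeHom (serreTranslateInv act E' hE' Q) (𝓨.genericIso'.inv.left ≫ pullback.fst 𝓨.total.hom (specGenericPoint (valuationSubringAtPrime K v) K))) x''.left) :=
        (haveI := isMonHom_serreTranslateInv act E' hE' Q; haveI := isMonHom_baseChangeHom (serreTranslateInv act E' hE' Q) (𝓨.genericIso'.inv.left ≫ pullback.fst 𝓨.total.hom (specGenericPoint (valuationSubringAtPrime K v) K));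
          isMonHom_baseChangeHom _ x''.left)
      refine retarget_comp_lam_comp_dualIsogenyOver q c (baseChangeHom (baseChangeHom (serreTranslate act E' hE' P) (𝓨.genericIso'.inv.left ≫ pullback.fst 𝓨.total.hom (specGenericPoint (valuationSubringAtPrime K v) K))) x''.left) E
        ((D.baseChange (𝓨.genericIso'.inv.left ≫ pullback.fst 𝓨.total.hom (specGenericPoint (valuationSubringAtPrime K v) K))).baseChange x.left) ((D.baseChange (𝓨.genericIso'.inv.left ≫ pullback.fst 𝓨.total.hom (specGenericPoint (valuationSubringAtPrime K v) K))).baseChange x''.left) DB ((Db.baseChange (𝓨.genericIso'.inv.left ≫ pullback.fst 𝓨.total.hom (specGenericPoint (valuationSubringAtPrime K v) K))).baseChange x''.left) hDB hDbη hE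
        ((pol.baseChange (𝓨.genericIso'.inv.left ≫ pullback.fst 𝓨.total.hom (specGenericPoint (valuationSubringAtPrime K v) K))).baseChange x.left).lam ((pol.baseChange (𝓨.genericIso'.inv.left ≫ pullback.fst 𝓨.total.hom (specGenericPoint (valuationSubringAtPrime K v) K))).baseChange x''.left).lam lamB (baseChangeHom (baseChangeHom lam' (𝓨.genericIso'.inv.left ≫ pullback.fst 𝓨.total.hom (specGenericPoint (valuationSubringAtPrime K v) K))) x''.left)
        (DualPair.dualIsogenyOver (baseChangeHom (baseChangeHom (serreTranslateInv act E' hE' Q) (𝓨.genericIso'.inv.left ≫ pullback.fst 𝓨.total.hom (specGenericPoint (valuationSubringAtPrime K v) K))) x''.left)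
          ((Db.baseChange (𝓨.genericIso'.inv.left ≫ pullback.fst 𝓨.total.hom (specGenericPoint (valuationSubringAtPrime K v) K))).baseChange x''.left) ((D.baseChange (𝓨.genericIso'.inv.left ≫ pullback.fst 𝓨.total.hom (specGenericPoint (valuationSubringAtPrime K v) K))).baseChange x''.left))
        hN (dualIsogenyOver_coverLeg_comp_eq_pow_id (𝓨.genericIso'.inv.left ≫ pullback.fst 𝓨.total.hom (specGenericPoint (valuationSubringAtPrime K v) K)) x''.left act E' hE' P Q hP hQ hPQ _ _ hDbη) hq3 hc3 ?_
      simpa only [Polarization.baseChange_lam] using hψl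
    -- multiply by `N`: the law for the POLARISATION `λ^{pull}` with scalar `N²`
    have hpullη : baseChangeHom (baseChangeHom (serreTwistLamPull act E' hE' Q D Db pol) (𝓨.genericIso'.inv.left ≫ pullback.fst 𝓨.total.hom (specGenericPoint (valuationSubringAtPrime K v) K))) x''.left =
        baseChangeHom (baseChangeHom lam' (𝓨.genericIso'.inv.left ≫ pullback.fst 𝓨.total.hom (specGenericPoint (valuationSubringAtPrime K v) K))) x''.left ≫ ((Db.baseChange (𝓨.genericIso'.inv.left ≫ pullback.fst 𝓨.total.hom (specGenericPoint (valuationSubringAtPrime K v) K))).baseChange x''.left).hat.mulN N :=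
      baseChangeHom_baseChangeHom_of_pow_id_comp_eq Db lam' (𝓨.genericIso'.inv.left ≫ pullback.fst 𝓨.total.hom (specGenericPoint (valuationSubringAtPrime K v) K)) x''.left _ hfac
    have hup2 := comp_comp_mulN_comp_dualIsogenyOver ((D.baseChange (𝓨.genericIso'.inv.left ≫ pullback.fst 𝓨.total.hom (specGenericPoint (valuationSubringAtPrime K v) K))).baseChange x.left) ((Db.baseChange (𝓨.genericIso'.inv.left ≫ pullback.fst 𝓨.total.hom (specGenericPoint (valuationSubringAtPrime K v) K))).baseChange x''.left) hDηx hDbη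
      (q ≫ E.inv) ((pol.baseChange (𝓨.genericIso'.inv.left ≫ pullback.fst 𝓨.total.hom (specGenericPoint (valuationSubringAtPrime K v) K))).baseChange x.left).lam (baseChangeHom (baseChangeHom lam' (𝓨.genericIso'.inv.left ≫ pullback.fst 𝓨.total.hom (specGenericPoint (valuationSubringAtPrime K v) K))) x''.left) N hup
    rw [← hpullη] at hup2
    -- transfer (★ (ν8)(iv)) for the polarisation `serreTwistPolPull`
    have h := h4 D pol Db (serreTwistPolPull act E' hE' P Q D Db hD hDb pol hN hP hQ hQP hPQ) (N * N) (by
      rw [Polarization.baseChange_lam, Polarization.baseChange_lam, serreTwistPolPull_lam]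
      exact hup2)
    -- divide by `N` downstairs
    have hDbs := DualPair.nonempty_unitHatSlice_baseChange_iso (g := (𝓨.geomReductionMap x'').left) _
      (DualPair.nonempty_unitHatSlice_baseChange_iso (g := (pullback.fst 𝓨.total.hom (specResidueField v))) Db hDb)
    have hDs := DualPair.nonempty_unitHatSlice_baseChange_iso (g := (𝓨.geomReductionMap x).left) _
      (DualPair.nonempty_unitHatSlice_baseChange_iso (g := (pullback.fst 𝓨.total.hom (specResidueField v))) D hD)
    have hpulls : baseChangeHom (baseChangeHom (serreTwistLamPull act E' hE' Q D Db pol) (pullback.fst 𝓨.total.hom (specResidueField v))) (𝓨.geomReductionMap x'').left =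
        baseChangeHom (baseChangeHom lam' (pullback.fst 𝓨.total.hom (specResidueField v))) (𝓨.geomReductionMap x'').left ≫ ((Db.baseChange (pullback.fst 𝓨.total.hom (specResidueField v))).baseChange (𝓨.geomReductionMap x'').left).hat.mulN N :=
      baseChangeHom_baseChangeHom_of_pow_id_comp_eq Db lam' (pullback.fst 𝓨.total.hom (specResidueField v)) (𝓨.geomReductionMap x'').left _ hfac
    rw [Polarization.baseChange_lam, Polarization.baseChange_lam, serreTwistPolPull_lam] at h
    change qbar ≫ baseChangeHom (baseChangeHom (serreTwistLamPull act E' hE' Q D Db pol) (pullback.fst 𝓨.total.hom (specResidueField v))) (𝓨.geomReductionMap x'').left ≫ _ = _ at h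
    rw [hpulls] at h
    haveI : IsMonHom (baseChangeHom (baseChangeHom lam' (pullback.fst 𝓨.total.hom (specResidueField v))) (𝓨.geomReductionMap x'').left) :=
      (haveI := isMonHom_baseChangeHom lam' (pullback.fst 𝓨.total.hom (specResidueField v)); isMonHom_baseChangeHom _ (𝓨.geomReductionMap x'').left)
    haveI := ((pol.baseChange (pullback.fst 𝓨.total.hom (specResidueField v))).baseChange (𝓨.geomReductionMap x).left).isMonHom
    have hfin := comp_lam_comp_dualIsogenyOver_of_comp_mulN ((D.baseChange (pullback.fst 𝓨.total.hom (specResidueField v))).baseChange (𝓨.geomReductionMap x).left)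
      ((Db.baseChange (pullback.fst 𝓨.total.hom (specResidueField v))).baseChange (𝓨.geomReductionMap x'').left) hDs hDbs qbar ((pol.baseChange (pullback.fst 𝓨.total.hom (specResidueField v))).baseChange (𝓨.geomReductionMap x).left).lam
      (baseChangeHom (baseChangeHom lam' (pullback.fst 𝓨.total.hom (specResidueField v))) (𝓨.geomReductionMap x'').left) hN h
    rw [Polarization.baseChange_lam, Polarization.baseChange_lam] at hfin ⊢
    exact hfin

end HeadSections

end AbelianSchemeOver

end Literature.AlgebraicGeometry.AbelianSchemes

end
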